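import Summits.BirchSwinnertonDyer.BirchSwinnertonDyer.Theorems.GenusKolyvaginAtTwoEquivariantKolyvaginExactAtTwoReciprocityRat
import Summits.BirchSwinnertonDyer.BirchSwinnertonDyer.Theorems.GenusKolyvaginAtTwoEquivariantKolyvaginExactAtTwoDualityCounting
import Summits.BirchSwinnertonDyer.BirchSwinnertonDyer.Theorems.GenusKolyvaginAtTwoEquivariantKolyvaginExactAtTwoLocalDualityPerfect
import Literature.NumberTheory.EllipticCurves.CasselsTateSelmerKolyvaginValue
import HarnessLib

/-!
# Route `GenusKolyvaginAtTwo`, LINE 6, KEY crux Q3 (`EquivariantKolyvaginExactAtTwo`, inner statement of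
# stmt-BirchSwinnertonDyer-22137): the `duality` field of the split/pair descent over `ℚ_ℓ` at
# `p = 2`, UNCONDITIONALLY — McCallum's Lemma 5.3 with Prop. 2.2 by pure counting

Helper (seat `bsd-line-gk2-p3` g12; `--supports` the crux, closes nothing). Sequel to
`…ReciprocityRat` (§2 there: the `duality` field MODULO a displayed local shape à la Gross (7.6) for a
regular Frobenius action) and `…DualityCounting` (McCallum's "orders multiply" principle
`pow_smul_eq_zero_of_character_of_card`, abstract). This file carries out the INSTANTIATION RECIPE
recorded in `…DualityCounting`: with

* `H = H¹(K_v, E[p^k])`, `U = 𝓛_v = kummerLocalConditionAt` (the image of `E(K_v)/p^k`),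
* `ψ = (d_v ∪ₑ ·)` the Weil cup product against the localisation of a global class `d` which is
  Selmer off `v` (`ContPairing.cupProduct`, `ℤ`-bilinear),
* `x = s_v` for a Selmer class `s` (`mem_kummerLocalConditionAt_res_of_mem_selmerLocalKer`),
* `ψ x = 0` from POITOU–TATE (`§1`, the symmetric form of
  `…ReciprocityRat.cupProduct_localization_eq_zero_of_selmer`: both classes need only be Selmer off `v`),
* `p^a ψ ≢ 0` on `U` from `p^a d` NOT Selmer at `v` and `𝓛_v^⊥ = 𝓛_v`
  (`…LocalDualityPerfect.forall_mem_kummerLocalConditionAt_weilCupProduct_eq_zero_iff_of_not_mem`,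
  Tate local duality for `E` off `p`, PROVED in the tree),
* `#U = #E(K_v)[p^k]` off `p` (`natCard_kummerLocalConditionAt_adicCompletion`, Milne I Lemma 3.3),

the counting lemma yields **`p^{M−1−a}·s_v = 0` in `H¹(K_v, E[p^k])` whenever `#E(K_v)[p^k] = p^M`**
(`§2`, any number field, any prime `p`, any place `v ∤ p`), read back as membership of `p^{M−1−a}·s` in
the strict local kernel `torsionLocalKer` (`mem_torsionLocalKer_iff_res_eq_zero`). At a Gross–Kolyvagin
prime `ℓ` of depth `≥ M` for `E/ℚ` with `Δ(E) < 0` (`Frob_ℓ ∼ Frob_∞`, so `#E(ℚ_ℓ)[2^M] = 2^M` —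
this lineage's `ReductionCyclic.natCard_ker_zsmul_adicCompletion_two_pow_eq`) this is exactly
McCallum's Lemma 5.3 + Prop. 2.2 over `ℚ_ℓ` at `p = 2` (`§3`): **the hypothesis `hShape` of
`…ReciprocityRat.lemma_5_3_rat_two_of_tameShape` is GONE** — no Gross (7.6), no tame symbols, no
eigenvectors, no cyclicity. This is the `duality` field of the split/pair descent
(`KolyvaginDescent.SplitHypothesesM.duality`, file `HeegnerPointsKolyvaginSplitDescentProofs`) for each
factor `E`, `E^{d_K}` over `ℚ` at the place of a Kolyvagin prime.

* §1 `cupProduct_localization_eq_zero_of_selmer_off` — Poitou–Tate, symmetric form (any number field,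
  any level `n`): two global classes Selmer at every place `≠ v` have vanishing local cup product at `v`.
* §2 `pow_smul_mem_torsionLocalKer_of_card_torsion_eq` — the local duality step off `p` over any number
  field (`K : Type u` with the Poitou–Tate predicate as hypothesis; `…_holds`-discharged for `K : Type`
  in `pow_smul_mem_torsionLocalKer_of_card_torsion_eq'`).
* §3 `lemma_5_3_rat_two` — `E/ℚ` globally minimal, `Δ < 0`, `ℓ` odd good Gross–Kolyvagin prime of depth
  `≥ M`: `2^{M−1−a}·s ∈ torsionLocalKer` at `v ∣ ℓ`; and `lemma_5_3_rat_two_of_card` with the count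
  `#E(ℚ_v)[2^M] = 2^M` as the only local hypothesis (serves the twin `E^{d_K}` at the same prime).

THEOREMS ONLY (no definition, no named fact, no `sorry`, standard axioms). BSD is not proved by any of this.

References: [McCallumLMS1991] §2 Prop. 2.2, §5 Lemma 5.3 and proof of Thm. 5.4 ("orders multiply to
more than `p^M`"); [GrossLMS1991] Prop. 8.2; [MilneADT2006] I Cor. 2.3, Lemma 3.3, Cor. 3.4, Thm. 4.10(b),
Lemma 6.15; [PoonenRains2012] Prop. 4.10.
-/

set_option autoImplicit false
set_option linter.dupNamespace false -- tree convention: `Summit.BirchSwinnertonDyer.BirchSwinnertonDyer.Theorems` (summit = sub-problem)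

noncomputable section

open scoped Classical Pointwise

universe u

namespace Summit.BirchSwinnertonDyer.BirchSwinnertonDyer.Theorems.GenusExact.FrobeniusCriterion

open WeierstrassCurve NumberField IsDedekindDomain Field
open Literature.NumberTheory.EllipticCurves Literature.NumberTheory.GaloisRepresentations
open Literature.NumberTheory.GaloisCohomology
open Literature.NumberTheory.GaloisRepresentations.DiscreteGaloisModule (mu MuCarrier)
open Summit.BirchSwinnertonDyer.Rank1Residual.X11b

/-! ## §1 Poitou–Tate, symmetric form: two classes Selmer off `v` have vanishing local cup product at `v` -/

section Global

variable {K : Type u} [Field K] [NumberField K] (W : WeierstrassCurve K) [W.IsElliptic]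

/-- **The local cup product at `v` vanishes, symmetric form** (McCallum's Prop. 2.2 / Gross's proof of
Prop. 8.2, global half): for `E = W/K` elliptic, any `n ≥ 1`, a Weil pairing `e` on `E[n]`, the family
of local invariant maps of the Poitou–Tate predicate, a finite place `v`, and two classes
`s, d ∈ H¹(K, E[n])` EACH satisfying the Selmer condition at every finite place `≠ v` and at every
infinite place: the cup product of the localisations `s_v`, `d_v` on `Γ_{K_v}` is `0` in `H²(K_v, μₙ)`.
Every local term off `v` pairs two Kummer classes (isotropy, `kummerClass_cupProduct_kummerClass_eq_zero_holds`),
the Poitou–Tate sum over `S = {v}` vanishes, and `inv_v` is injective. (The tree's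
`cupProduct_localization_eq_zero_of_selmer` is the case `s ∈ Sel^{(n)}(E/K)`.)
[cite: McCallumLMS1991, §2 Prop. 2.2] [cite: GrossLMS1991, Prop. 8.2 (proof)] [cite: MilneADT2006, Ch. I Thm. 4.10(b)] -/
theorem cupProduct_localization_eq_zero_of_selmer_off (hPT : poitouTate_sum_localTatePairing_eq_zero K)
    {n : ℕ} [NeZero n] (e : geomTorsion W n → geomTorsion W n → AlgebraicClosure K)
    (hμ : ∀ S T, e S T ^ n = 1) (hadd₁ : ∀ S₁ S₂ T, e (S₁ + S₂) T = e S₁ T * e S₂ T)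
    (hadd₂ : ∀ S T₁ T₂, e S (T₁ + T₂) = e S T₁ * e S T₂) (halt : ∀ T, e T T = 1)
    (hgal : ∀ (σ : absoluteGaloisGroup K) (S T : geomTorsion W n), σ • e S T = e (σ • S) (σ • T))
    (v : HeightOneSpectrum (𝓞 K)) {s d : galH1Torsion W (n : ℤ)}
    (hsfin : ∀ w : HeightOneSpectrum (𝓞 K), w ≠ v → s ∈ selmerLocalKer W (w.adicCompletion K) (n : ℤ))
    (hsinf : ∀ w : InfinitePlace K, s ∈ selmerLocalKer W w.Completion (n : ℤ))
    (hdfin : ∀ w : HeightOneSpectrum (𝓞 K), w ≠ v → d ∈ selmerLocalKer W (w.adicCompletion K) (n : ℤ))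
    (hdinf : ∀ w : InfinitePlace K, d ∈ selmerLocalKer W w.Completion (n : ℤ)) :
    haveI := absoluteGaloisGroup_compactSpace (v.adicCompletion K)
    ((weilContPairing W n e hμ hadd₁ hadd₂ hgal).restrict
      (absGaloisRestrict K (v.adicCompletion K))).cupProduct
        (galoisCohomology.localization (W.torsionGaloisModule ((n : ℕ) : ℤ)) (Sum.inr v) 1 s)
        (galoisCohomology.localization (W.torsionGaloisModule ((n : ℕ) : ℤ)) (Sum.inr v) 1 d) = 0 := by
  have _hΓc : ∀ (L : Type u) [Field L], CompactSpace (absoluteGaloisGroup L) :=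
    fun L _ => absoluteGaloisGroup_compactSpace L
  -- the family of local invariant maps of the Poitou–Tate predicate at level `n`
  obtain ⟨inv, hperf, hsum⟩ := hPT n
  -- the finite set of places `S = {v}`
  set S : Finset (Place K) := {Sum.inr v} with hSdef
  have hmemS : Sum.inr v ∈ S := Finset.mem_singleton_self _
  -- off `S` both classes satisfy the Kummer condition (isotropy applies)
  have hloc : ∀ {c : galH1Torsion W (n : ℤ)},
      (∀ w : HeightOneSpectrum (𝓞 K), w ≠ v → c ∈ selmerLocalKer W (w.adicCompletion K) (n : ℤ)) →
      (∀ w : InfinitePlace K, c ∈ selmerLocalKer W w.Completion (n : ℤ)) →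
      ∀ w : Place K, w ∉ S →
        galoisCohomology.localization (W.torsionGaloisModule ((n : ℕ) : ℤ)) w 1 c ∈
          W.kummerSelmerStructure ((n : ℕ) : ℤ) w := by
    intro c hcfin hcinf w hw
    have hmem : c ∈ selmerLocalKer W (Place.Completion w) ((n : ℕ) : ℤ) := by
      rcases w with w | w
      · exact hcinf w
      · refine hcfin w (fun h => hw ?_)
        rw [h]
        exact hmemS
    rw [← W.comap_localization_kummerSelmerStructure ((n : ℕ) : ℤ) w] at hmem
    exact hmem
  have hS : ∀ w ∉ S,
      inv w ((weilContPairingLocal W n e hμ hadd₁ hadd₂ hgal w).cupProduct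
        (galoisCohomology.localization (W.torsionGaloisModule ((n : ℕ) : ℤ)) w 1 s)
        (galoisCohomology.localization (W.torsionGaloisModule ((n : ℕ) : ℤ)) w 1 d)) = 0 := by
    intro w hw
    have h0 := W.cupProduct_eq_zero_of_mem_kummerSelmerStructure_of_fact n e
      (by exact_mod_cast NeZero.ne n) w (kummerClass_cupProduct_kummerClass_eq_zero_holds (Place.Completion w))
      hμ hadd₁ hadd₂ halt hgal (hloc hsfin hsinf w hw) (hloc hdfin hdinf w hw)
    exact (congrArg (inv w) h0).trans (map_zero _)
  -- Poitou–Tate: the local term at `v` vanishes too, hence the local cup product is zero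
  have hPTsum := sum_inv_weilCupProduct_localization_eq_zero W n e hμ hadd₁ hadd₂ hgal inv hsum s d S hS
  rw [Finset.sum_singleton] at hPTsum
  exact (hperf v).1.injective (hPTsum.trans (map_zero _).symm)

end Global

/-! ## §2 The local duality step off `p`: `p^{M−1−a}·s_v = 0` by counting -/

section OffP

/-- `B (n • x) y = n • B x y` for an `R`-bilinear map `B` and `n : ℕ` — pure additivity in the first
argument (used for the Weil cup product, whose first argument lives in a definitionally-but-not-
syntactically equal copy of the local cohomology group, so that no scalar-action instance on linear
maps is needed). [folklore] -/
theorem map_nsmul_apply_left {R : Type*} [CommSemiring R] {X Y Z : Type*} [AddCommMonoid X]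
    [AddCommMonoid Y] [AddCommMonoid Z] [Module R X] [Module R Y] [Module R Z]
    (B : X →ₗ[R] Y →ₗ[R] Z) (n : ℕ) (x : X) (y : Y) : B (n • x) y = n • B x y := by
  induction n with
  | zero => rw [zero_nsmul, zero_nsmul, map_zero, LinearMap.zero_apply]
  | succ n ih => rw [succ_nsmul, succ_nsmul, map_add, LinearMap.add_apply, ih]

variable {K : Type u} [Field K] [NumberField K] (W : WeierstrassCurve K) [W.IsElliptic]

/-- **McCallum's Lemma 5.3 with Prop. 2.2, over any number field, at a place `v ∤ p`, by COUNTING.**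
Let `E = W/K` be elliptic, `p` prime, `q = p^k` (`k ≠ 0`), `v` a finite place with `v ∤ p` and
**`#E(K_v)[q] = p^M`**. Let `s ∈ Sel^{(q)}(E/K)` and let `d ∈ H¹(K, E[q])` satisfy the Selmer condition at
every finite place `≠ v` and at every infinite place, while `p^a·d` is NOT Selmer at `v`. Then
**`p^{M−1−a}·s ∈ torsionLocalKer_v`**, i.e. `p^{M−1−a}·s_v = 0` in `H¹(K_v, E[q])`. Proof: in
`H = H¹(K_v, E[q])` take `U = 𝓛_v` (`#U = #E(K_v)[q]·#(𝓞_v/q) = p^M`, Milne I Lemma 3.3), the character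
`ψ = (d_v ∪ₑ ·)` for a Weil pairing `e`; `ψ(s_v) = 0` by Poitou–Tate (§1); if `p^a ψ` vanished on `U` then
`(p^a d)_v ∈ U^⊥ = U` (Tate local duality for `E`, `…LocalDualityPerfect`), i.e. `p^a d` Selmer at `v`;
so the counting lemma `pow_smul_eq_zero_of_character_of_card` gives `p^{M−1−a}·s_v = 0`. The Poitou–Tate
predicate `hPT` is a hypothesis here (universe-polymorphic `K`); it is discharged for `K : Type` below.
[cite: McCallumLMS1991, §5 Lemma 5.3 and §2 Prop. 2.2] [cite: MilneADT2006, Ch. I Cor. 3.4, Lemma 3.3] -/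
theorem pow_smul_mem_torsionLocalKer_of_card_torsion_eq (hPT : poitouTate_sum_localTatePairing_eq_zero K)
    {p : ℕ} (hp : p.Prime) {k : ℕ} (hk : k ≠ 0) {q : ℕ} (hq : q = p ^ k) [NeZero q]
    (v : HeightOneSpectrum (𝓞 K)) (hpv : (p : 𝓞 K) ∉ v.asIdeal) {M : ℕ}
    (hcard : Nat.card (nsmulAddMonoidHom q :
        (W.baseChange (v.adicCompletion K)).toAffine.Point →+ _).ker = p ^ M)
    {s : galH1Torsion W (q : ℤ)} (hs : s ∈ selmerGroup W (q : ℤ))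
    {d : galH1Torsion W (q : ℤ)}
    (hdfin : ∀ w : HeightOneSpectrum (𝓞 K), w ≠ v → d ∈ selmerLocalKer W (w.adicCompletion K) (q : ℤ))
    (hdinf : ∀ w : InfinitePlace K, d ∈ selmerLocalKer W w.Completion (q : ℤ))
    {a : ℕ} (hdv : ((p : ℤ) ^ a) • d ∉ selmerLocalKer W (v.adicCompletion K) (q : ℤ)) :
    ((p : ℤ) ^ (M - 1 - a)) • s ∈ W.torsionLocalKer (v.adicCompletion K) (q : ℤ) := by
  have _hΓc : ∀ (L : Type u) [Field L], CompactSpace (absoluteGaloisGroup L) :=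
    fun L _ => absoluteGaloisGroup_compactSpace L
  haveI : Fact p.Prime := ⟨hp⟩
  subst hq
  haveI hK0 : CharZero (v.adicCompletion K) := charZero_adicCompletion v
  have hq2 : 2 ≤ p ^ k := le_trans hp.two_le (Nat.le_self_pow hk p)
  have hq0 : p ^ k ≠ 0 := NeZero.ne _
  have hqK : ((p ^ k : ℕ) : K) ≠ 0 := Nat.cast_ne_zero.mpr hq0
  -- the Weil pairing on `E[p^k]`
  obtain ⟨e, hμ, hadd₁, hadd₂, halt, hnondeg, hgal⟩ := W.exists_weilPairing_holds (p ^ k) hq2 hqK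
  -- local objects at `v`
  set loc := galoisCohomology.localization (W.torsionGaloisModule ((p ^ k : ℕ) : ℤ)) (Sum.inr v) 1
    with hloc
  set U := W.kummerLocalConditionAt ((p ^ k : ℕ) : ℤ) (v.adicCompletion K) with hU
  set cup := ((weilContPairing W (p ^ k) e hμ hadd₁ hadd₂ hgal).restrict
      (absGaloisRestrict K (v.adicCompletion K))).cupProduct with hcup
  -- `#U = p^M`
  have hUcard : Nat.card U = p ^ M := by
    rw [hU, W.natCard_kummerLocalConditionAt_adicCompletion v hq0,
      LocalDualityOrder.natCard_quotient_span_natCast_eq_one v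
        (LocalDualityOrder.natCast_pow_notMem v hpv k), mul_one, hcard]
  -- `x = s_v ∈ U`
  have hsv : s ∈ selmerLocalKer W (v.adicCompletion K) ((p ^ k : ℕ) : ℤ) :=
    ((mem_selmerGroup_iff W _ s).mp hs).1 v
  have hx : loc s ∈ U :=
    mem_kummerLocalConditionAt_res_of_mem_selmerLocalKer W _ _ hsv
  -- the character `ψ = (d_v ∪ ·)`
  set ψ : galoisCohomology ((W.torsionGaloisModule ((p ^ k : ℕ) : ℤ)).toLocal (Sum.inr v)) 1 →+
      _ := (cup (loc d)).toAddMonoidHom with hψ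
  have hψapp : ∀ y, ψ y = cup (loc d) y := fun _ => rfl
  -- `ψ (s_v) = 0`: Poitou–Tate (symmetric form, `d` first)
  have hsfin : ∀ w : HeightOneSpectrum (𝓞 K), w ≠ v →
      s ∈ selmerLocalKer W (w.adicCompletion K) ((p ^ k : ℕ) : ℤ) :=
    fun w _ => ((mem_selmerGroup_iff W _ s).mp hs).1 w
  have hsinf : ∀ w : InfinitePlace K, s ∈ selmerLocalKer W w.Completion ((p ^ k : ℕ) : ℤ) :=
    fun w => ((mem_selmerGroup_iff W _ s).mp hs).2 w
  have hψx : ψ (loc s) = 0 := by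
    rw [hψapp]
    exact cupProduct_localization_eq_zero_of_selmer_off W hPT e hμ hadd₁ hadd₂ halt hgal v
      hdfin hdinf hsfin hsinf
  -- `p^a ψ` does not vanish on `U`: otherwise `(p^a d)_v ∈ U^⊥ = U`, i.e. `p^a d` Selmer at `v`
  have hnot : ¬ ∀ y ∈ U, (p ^ a) • ψ y = 0 := by
    intro hall
    apply hdv
    have hlocd : loc (((p : ℤ) ^ a) • d) = (p ^ a) • loc d := by
      rw [← Nat.cast_pow, natCast_zsmul]; exact map_nsmul _ _ d
    have hmem : loc (((p : ℤ) ^ a) • d) ∈ U := by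
      refine (LocalDualityOrder.forall_mem_kummerLocalConditionAt_weilCupProduct_eq_zero_iff_of_not_mem
        v W hk hpv e hμ hadd₁ hadd₂ hgal halt hnondeg _).mp fun y hy => ?_
      have h := hall y hy
      rw [hψapp] at h
      have h2 : cup ((p ^ a) • loc d) y = (p ^ a) • cup (loc d) y :=
        map_nsmul_apply_left cup (p ^ a) (loc d) y
      rw [hlocd]
      exact h2.trans h
    exact mem_selmerLocalKer_of_mem_kummerLocalConditionAt_res W _ _ hmem
  -- the counting lemma: `p^{M-1-a} · s_v = 0`
  have hkill : (p ^ (M - 1 - a)) • loc s = 0 :=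
    pow_smul_eq_zero_of_character_of_card hp hUcard ψ hnot hx hψx
  -- read back as membership in the strict local kernel
  have hlocs : loc (((p : ℤ) ^ (M - 1 - a)) • s) = (p ^ (M - 1 - a)) • loc s := by
    rw [← Nat.cast_pow, natCast_zsmul]; exact map_nsmul _ _ s
  rw [mem_torsionLocalKer_iff_res_eq_zero W (v.adicCompletion K) hq0]
  exact hlocs.trans hkill

/-- `pow_smul_mem_torsionLocalKer_of_card_torsion_eq` with Poitou–Tate DISCHARGED (`K : Type`; the
tree's `poitouTate_sum_localTatePairing_eq_zero_holds`, proved for every number field): for `v ∤ p`,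
`#E(K_v)[p^k] = p^M`, `s` Selmer, `d` Selmer off `v` with `p^a d` not Selmer at `v`:
`p^{M−1−a}·s ∈ torsionLocalKer_v`. [cite: McCallumLMS1991, §5 Lemma 5.3 and §2 Prop. 2.2]
[cite: MilneADT2006, Ch. I Cor. 3.4, Thm. 4.10(b)] -/
theorem pow_smul_mem_torsionLocalKer_of_card_torsion_eq' {K : Type} [Field K] [NumberField K]
    (W : WeierstrassCurve K) [W.IsElliptic]
    {p : ℕ} (hp : p.Prime) {k : ℕ} (hk : k ≠ 0) {q : ℕ} (hq : q = p ^ k) [NeZero q]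
    (v : HeightOneSpectrum (𝓞 K)) (hpv : (p : 𝓞 K) ∉ v.asIdeal) {M : ℕ}
    (hcard : Nat.card (nsmulAddMonoidHom q :
        (W.baseChange (v.adicCompletion K)).toAffine.Point →+ _).ker = p ^ M)
    {s : galH1Torsion W (q : ℤ)} (hs : s ∈ selmerGroup W (q : ℤ))
    {d : galH1Torsion W (q : ℤ)}
    (hdfin : ∀ w : HeightOneSpectrum (𝓞 K), w ≠ v → d ∈ selmerLocalKer W (w.adicCompletion K) (q : ℤ))
    (hdinf : ∀ w : InfinitePlace K, d ∈ selmerLocalKer W w.Completion (q : ℤ))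
    {a : ℕ} (hdv : ((p : ℤ) ^ a) • d ∉ selmerLocalKer W (v.adicCompletion K) (q : ℤ)) :
    ((p : ℤ) ^ (M - 1 - a)) • s ∈ W.torsionLocalKer (v.adicCompletion K) (q : ℤ) :=
  pow_smul_mem_torsionLocalKer_of_card_torsion_eq W (poitouTate_sum_localTatePairing_eq_zero_holds K)
    hp hk hq v hpv hcard hs hdfin hdinf hdv

end OffP

/-! ## §3 Over `ℚ_ℓ` at `p = 2`: McCallum's Lemma 5.3 at a Gross–Kolyvagin prime, unconditionally -/

section Rat

variable (W : WeierstrassCurve ℚ) [W.IsElliptic]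

/-- **The `duality` field over `ℚ_ℓ` at `2`, from the local count only.** For `E = W/ℚ`, `q = 2^M`
(`M ≥ 1`), an odd prime `ℓ` below the place `v` with **`#E(ℚ_v)[2^M] = 2^M`**, `s ∈ Sel^{(q)}(E/ℚ)` and
`d ∈ H¹(ℚ, E[q])` Selmer at the finite places `≠ v` and at `∞` with `2^a d` NOT Selmer at `v`:
**`2^{M−1−a}·s ∈ torsionLocalKer_v`**. (The count holds for `E` AND for its twin `E^{d_K}` at a
Gross–Kolyvagin prime of depth `≥ M`, so this form serves both factors of the pair descent.)
[cite: McCallumLMS1991, §5 Lemma 5.3 and §2 Prop. 2.2] [cite: MilneADT2006, Ch. I Cor. 3.4] -/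
theorem lemma_5_3_rat_two_of_card {M : ℕ} (hM : 1 ≤ M) {q : ℕ} (hq : q = 2 ^ M) [NeZero q]
    {ℓ : ℕ} [Fact ℓ.Prime] (hℓ2 : ℓ ≠ 2) {v : HeightOneSpectrum (𝓞 ℚ)} (hℓv : (ℓ : 𝓞 ℚ) ∈ v.asIdeal)
    (hcard : Nat.card (nsmulAddMonoidHom q :
        (W.baseChange (v.adicCompletion ℚ)).toAffine.Point →+ _).ker = 2 ^ M)
    {s : galH1Torsion W (q : ℤ)} (hs : s ∈ selmerGroup W (q : ℤ))
    {d : galH1Torsion W (q : ℤ)}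
    (hdfin : ∀ w : HeightOneSpectrum (𝓞 ℚ), w ≠ v → d ∈ selmerLocalKer W (w.adicCompletion ℚ) (q : ℤ))
    (hdinf : ∀ w : InfinitePlace ℚ, d ∈ selmerLocalKer W w.Completion (q : ℤ))
    {a : ℕ} (hdv : ((2 : ℤ) ^ a) • d ∉ selmerLocalKer W (v.adicCompletion ℚ) (q : ℤ)) :
    ((2 : ℤ) ^ (M - 1 - a)) • s ∈ W.torsionLocalKer (v.adicCompletion ℚ) (q : ℤ) := by
  have h2v : ((2 : ℕ) : 𝓞 ℚ) ∉ v.asIdeal := LocalDualityOrder.two_notMem_of_odd_prime_mem hℓ2 hℓv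
  have h := pow_smul_mem_torsionLocalKer_of_card_torsion_eq' W Nat.prime_two
    (Nat.one_le_iff_ne_zero.mp hM) hq v h2v (M := M) (by exact_mod_cast hcard) hs hdfin hdinf
    (a := a) (by exact_mod_cast hdv)
  exact_mod_cast h

/-- **McCallum's Lemma 5.3 with Prop. 2.2 over `ℚ_ℓ` at `p = 2`, UNCONDITIONAL** — the hypothesis-free
form of `…ReciprocityRat.lemma_5_3_rat_two_of_tameShape` (no Gross (7.6), no tame symbols, no
eigenvectors). Setting: `E = W/ℚ` globally minimal with `Δ(E) < 0`, `q = 2^M` (`M ≥ 1`), `ℓ` an odd prime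
of good reduction which is a Gross–Kolyvagin prime (`Frob_ℓ ∼ Frob_∞` on the `2`-division tower,
`FrobEqFrobInfty W K 2 ℓ`) of depth `M ≤ n(ℓ)` (`kolyvaginIndex`), `v ∣ ℓ`; `s ∈ Sel^{(q)}(E/ℚ)`,
`d ∈ H¹(ℚ, E[q])` Selmer at the finite places `≠ v` and at `∞`, `2^a d` NOT Selmer at `v`. CONCLUSION:
**`2^{M−1−a}·s ∈ torsionLocalKer_v`** ("`ord s_λ ≤ p^{M−1−a}`"). Ingredients, all PROVED in the tree:
`#E(ℚ_ℓ)[2^M] = 2^M` (`ReductionCyclic.natCard_ker_zsmul_adicCompletion_two_pow_eq`), Tate local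
duality for `E` off `2` (`𝓛^⊥ = 𝓛`), Milne I Lemma 3.3 (`#𝓛`), Poitou–Tate over `ℚ`, and the counting
lemma. This is the `duality` field of `KolyvaginDescent.SplitHypothesesM` for the factor `E` over `ℚ`.
[cite: McCallumLMS1991, §5 Lemma 5.3, §2 Prop. 2.2] [cite: GrossLMS1991, Prop. 8.2]
[cite: MilneADT2006, Ch. I Cor. 3.4, Lemma 3.3, Thm. 4.10(b)] -/
theorem lemma_5_3_rat_two [W.IsGloballyMinimal] (hΔ : W.Δ < 0) {M : ℕ} (hM : 1 ≤ M) {q : ℕ}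
    (hq : q = 2 ^ M) [NeZero q] {ℓ : ℕ} [Fact ℓ.Prime] (hℓ2 : ℓ ≠ 2) {v : HeightOneSpectrum (𝓞 ℚ)}
    (hℓv : (ℓ : 𝓞 ℚ) ∈ v.asIdeal) (hgood : W.HasGoodReductionAtPrime ℓ) {K : Type} [Field K]
    [NumberField K] (hℓK : FrobEqFrobInfty W K 2 ℓ) (hMℓ : M ≤ Zhang2014.kolyvaginIndex W 2 ℓ)
    {s : galH1Torsion W (q : ℤ)} (hs : s ∈ selmerGroup W (q : ℤ))
    {d : galH1Torsion W (q : ℤ)}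
    (hdfin : ∀ w : HeightOneSpectrum (𝓞 ℚ), w ≠ v → d ∈ selmerLocalKer W (w.adicCompletion ℚ) (q : ℤ))
    (hdinf : ∀ w : InfinitePlace ℚ, d ∈ selmerLocalKer W w.Completion (q : ℤ))
    {a : ℕ} (hdv : ((2 : ℤ) ^ a) • d ∉ selmerLocalKer W (v.adicCompletion ℚ) (q : ℤ)) :
    ((2 : ℤ) ^ (M - 1 - a)) • s ∈ W.torsionLocalKer (v.adicCompletion ℚ) (q : ℤ) := by
  refine lemma_5_3_rat_two_of_card W hM hq hℓ2 hℓv ?_ hs hdfin hdinf hdv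
  rw [hq, ← zsmulAddGroupHom_natCast]
  exact ReductionCyclic.natCard_ker_zsmul_adicCompletion_two_pow_eq W hΔ hℓ2 hgood hℓK hℓv hMℓ

end Rat

end Summit.BirchSwinnertonDyer.BirchSwinnertonDyer.Theorems.GenusExact.FrobeniusCriterion

end
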